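import Summits.BirchSwinnertonDyer.BirchSwinnertonDyer.Theorems.ResidualThetaTransportAtTwoThetaLayerLambdaCongruenceAtTwoCruxOfPlusSymbolMax
import Summits.BirchSwinnertonDyer.BirchSwinnertonDyer.Theorems.ResidualThetaTransportAtTwoThetaLayerLambdaCongruenceAtTwoUndepletedMaxOfCuspSpan
import Summits.BirchSwinnertonDyer.BirchSwinnertonDyer.Theorems.ResidualThetaTransportAtTwoSignedMuVanishingAtTwoPlusCuspSpanNamed
import Summits.BirchSwinnertonDyer.BirchSwinnertonDyer.Theorems.ResidualThetaTransportAtTwoThetaLayerLambdaCongruenceAtTwoCurveMuIffFlat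
import Summits.BirchSwinnertonDyer.BirchSwinnertonDyer.Theorems.ResidualThetaTransportAtTwoSignedMuVanishingAtTwoPlusAnalyticChild
import HarnessLib

/-!
# ITEM CERTIFICATE for the route pen — crux Kan⁺ `ThetaLayerLambdaCongruenceAtTwo` (stmt-BirchSwinnertonDyer-20688), line `birth` v11
# (lead prover bsd-wall-rtt-p3 g8, 2026-08-28). A CRUX WORKFILE (`Cruxes/ThetaLayerLambdaCongruenceAtTwo/KanPItemCert.lean`), not a
# Theorems proposal: it states CANDIDATE ITEM TEXTS as `def … : Prop` and proves, sorry-free over LANDED modules only, that they close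
# the crux BY NAME. Nothing here is asserted to hold; the two research texts are conjecture-grade (analytic μ⁺ = 0 at p = 2). BSD is
# not proved by any of this.

WHAT THE PEN GETS (all theorems below elaborate, rc 0, 0 sorry, std axioms):

* `PubFactsKanPlus`            — the PRINT binder: conjunction of the SEVEN Literature named facts consumed by the plus line (= the
                                 registered stub `stub_pubFactsKanPlus` of skeleton v11, `Iff.rfl`): a PUB support item / binder list.
* `PlusSymbolMaxAtTwoPowerCusp` — (μ-W₀), CURVE-LEVEL research text (= registered stub `stub_curvePlusSymbolMaxAtTwoPowerCusp`,
                                 `Iff.rfl`): «for every habitat⁺ curve W and its newform f, the undepleted rational plus symbol [·]⁺_f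
                                 attains its 2-adic maximum over ℚ at a 2-power cusp γ^s/2^{n₁+2} of an EVEN layer n₁» = μ(ϑ_{n₁}(f)) = 0
                                 at the cohomological period (Perrin-Riou/Pollack μ⁺ = 0 read at p = 2). Kit: 596/596 classes < 10⁴.
* `CuspSpanEvenAtTwoOdd`        — (G′), LEVEL-ONLY research text: «for every odd N, SignedMuAtTwo.CuspSpanEvenAtTwo N» (rtt-p4 g5's
                                 @[conjecture] predicate p595076: the closed loops {0 → b/4^k} span ker(H₁(X₀(N);𝔽₂) → Q_N ⊗ 𝔽₂)).
                                 Kit: every odd N ≤ 2999, all 147 habitat⁺ conductors < 10⁴. STRONGER than (μ-W₀) (implies it: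
                                 `plusSymbolMax_of_cuspSpanOdd`), but curve-free, decidable per level by exact 𝔽₂-linear algebra, and
                                 it ALSO closes Kμ⁺'s analytic child 21437 modulo Abbes–Ullmo (`…CuspSpanNamed`).
* `FlatMuZeroAtTwoText`        — FLAT, CURVE-LEVEL research text of the SIBLING crux Kμ⁺ (= the registered stub `stub_flatMuZeroAtTwo :
                                 FlatMuZeroAtTwo` of `Cruxes/SignedMuVanishingAtTwoPlus/Lines/birth.lean`, VERBATIM): «for every habitat⁺
                                 curve W, its newform f and every Pollack pair (L⁺, L⁻) of f at 2: 2 ∤ L⁻ in Λ = ℤ₂⟦T⟧» (μ(L⁻_f) = 0,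
                                 Pollack 2003 Conj. 6.3 at p = 2). KERNEL-EQUIVALENT to (μ-W₀): `plusSymbolMax_iff_flat` (width seat w2 g2's
                                 `curvePlusSymbolMax_iff_flatMuZeroAtTwo`, p611018). So Kan⁺'s research residue IS Kμ⁺'s FLAT stub.
* closers: `kanP_closes` : PubFactsKanPlus → PlusSymbolMaxAtTwoPowerCusp → Kan⁺ (one `exact` over p609241);
           `kanP_closes_of_flat` : PubFactsKanPlus → FlatMuZeroAtTwoText → Kan⁺ (p611018);
           `kanP_closes_of_cuspSpanOdd` : PubFactsKanPlus → CuspSpanEvenAtTwoOdd → Kan⁺ (via p609376);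
           `plusSymbolMax_of_cuspSpanOdd`, `plusSymbolMax_of_cuspSpan_habitat` (level node ⟹ curve node, all levels / habitat levels);
           `signedMuAnalytic_of_cuspSpanOdd` : Abbes–Ullmo (by name) → CuspSpanEvenAtTwoOdd → SignedMuAnalyticAtTwoPlus (21437) — rtt-p4's
           theorem restated with the named text, to show ONE node serves both cruxes.

FINAL RECOMMENDATION (lead g8, 07:4xZ, supersedes the paragraph below): NO NEW conjecture-grade item is needed for Kan⁺. Granted the
print fact Abbes–Ullmo Thm A, FLAT ⟺ the EXISTING route item 21437 `SignedMuAnalyticAtTwoPlus` (rtt-p4's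
`signedMuAnalyticAtTwoPlus_iff_flatMuZero_of_abbesUllmo`), hence `kanP_closes_of_item21437` below: PubFactsKanPlus → Abbes–Ullmo →
SignedMuAnalyticAtTwoPlus → Kan⁺. File the twin «KanP := ES → F → MK → SD → Bz → Se → D → AU → SignedMuAnalyticAtTwoPlus →
ThetaLayerLambdaCongruenceAtTwo» (all binders BY NAME: eight Literature facts + the route decl 21437; born closed by
`…ThetaLayerLambdaCongruenceAtTwoOfSignedMuAnalytic.kanP_of_pub_of_signedMuAnalyticAtTwoPlus`, lead g8, or by `kanP_closes_of_item21437`)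
and retire 20688 to aside/derived. Skeleton v12 (a2517385c1e14469) registers exactly {PUB⁷, AU, 21437-by-name}.

EARLIER RECOMMENDATION (lead g8, updated after p611018): file ONE conjecture-grade CURVE-LEVEL research item with text `FlatMuZeroAtTwoText`
(= Kμ⁺'s registered stub VERBATIM = (μ-W₀) up to the kernel `Iff` `plusSymbolMax_iff_flat`; shortest text; the classical μ⁻ = 0
statement) — it is the research residue of BOTH Kan⁺ (20688; twin KanP := PubFactsKanPlus → FLAT → Kan⁺ body, closer
`kanP_closes_of_flat`) and Kμ⁺-analytic (21437 = FLAT + PeriodUnitAtTwo in rtt-p4's skeleton). Keep `CuspSpanEvenAtTwoOdd` as its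
recorded curve-free SUFFICIENT condition (per-level decidable certificate engine: `plusSymbolMax_of_cuspSpanOdd`,
`signedMuAnalytic_of_cuspSpanOdd`), not as the item (it is strictly stronger). Either way 20688 → aside (decl kept; ≈ 70 Theorems
modules name it). The lead's verdict on both texts: OPEN — they are
the analytic μ⁺ = 0 statement at p = 2 (cohomological normalisation) for the habitat⁺ newforms, resp. for all non-Eisenstein mod-2
eigenclasses of odd level; no printed mechanism reaches the lacunary denominators 4^k (see `Lines/birth.md`, `Lines/birth-muW0-instrument.md`,
and the lead's NOTES). BSD is not proved by any of this.
-/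

set_option autoImplicit false
-- justification: the `Summit.BirchSwinnertonDyer.BirchSwinnertonDyer.…` path repeats a component (route-file convention)
set_option linter.dupNamespace false

noncomputable section

open scoped Classical MatrixGroups

open CongruenceSubgroup Literature.NumberTheory.EllipticCurves Literature.NumberTheory.EllipticCurves.ModularForms
  Summit.BirchSwinnertonDyer.BirchSwinnertonDyer.Theorems

namespace Summit.BirchSwinnertonDyer.BirchSwinnertonDyer.Cruxes.ThetaLayerLambdaCongruenceAtTwo.KanPItemCert

/-- PRINT binder text (PUB): the conjunction of the seven Literature named facts of the plus line and of the partner side —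
Eichler–Shimura for the depleted optimal quotient, Faltings' isogeny theorem, Mazur–Kenku, Hecke self-duality of `J₀[2]`, Buzzard's
mod-2 multiplicity one, Serre 1972 Prop. 12, Deligne Weil I Thm. 8.2 — BY NAME. Candidate text of a PUB support item; identical to the
registered stub `stub_pubFactsKanPlus` of skeleton v11. Nothing asserted. -/
def PubFactsKanPlus : Prop :=
  Literature.NumberTheory.EllipticCurves.ModularForms.eichlerShimura_depletedOptimalQuotient_periodLattice_of_dvd ∧
    WeierstrassCurve.isIsogenous_iff_frobeniusTrace_eq ∧
    Literature.NumberTheory.EllipticCurves.mazurKenku_exists_cyclic_isogeny ∧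
    Literature.NumberTheory.EllipticCurves.ModularForms.heckeSelfDual_torsionBy_J0 ∧
    Literature.NumberTheory.EllipticCurves.ModularForms.buzzard2000_multiplicityOne_gamma0 ∧
    Literature.NumberTheory.EllipticCurves.serre1972_supersingular_decompositionSubgroup_image ∧
    Literature.NumberTheory.EllipticCurves.ModularForms.Deligne1974_heckeT_eigenvalue_norm_le

/-- (μ-W₀) — CURVE-LEVEL research text: for `W` on the habitat⁺ and its newform `f`, the undepleted rational plus symbol `[·]⁺_f`
(read in `ℚ̄₂`) attains its `2`-adic maximum over `ℚ` at a `2`-power cusp `γ^s/2^{n₁+2}` of some EVEN layer `n₁`; equivalently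
`μ(ϑ_{n₁}(f)) = 0` at the cohomological (ℚ-primitive) period for one even layer = Perrin-Riou's / Pollack's `μ⁺ = 0` conjecture read at
`p = 2`. CONJECTURE-GRADE; identical to the registered stub `stub_curvePlusSymbolMaxAtTwoPowerCusp` of skeleton v11 `c6cf6b878390d60d`.
Nothing asserted. -/
def PlusSymbolMaxAtTwoPowerCusp : Prop :=
  ∀ (W : WeierstrassCurve ℚ) [W.IsElliptic] [W.IsGloballyMinimal], ¬ W.HasCM → W.analyticRank = 0 → Literature.NumberTheory.EllipticCurves.Rank1Residual.GoodSS W 2 → W.frobeniusTrace 2 = 0 → W.Δ < 0 → ∀ [NeZero (W.conductorNorm ℤ)] (f : CuspForm (CongruenceSubgroup.Gamma0 (W.conductorNorm ℤ)) 2), Literature.NumberTheory.EllipticCurves.ModularForms.IsNewformOf W f → ∃ n₁ : ℕ, Even n₁ ∧ ∃ s : ZMod (2 ^ n₁), ∀ r : ℚ, ‖algebraMap ℚ (PadicAlgCl 2) (Literature.NumberTheory.EllipticCurves.ratPlusSymbol f r)‖ ≤ ‖algebraMap ℚ (PadicAlgCl 2) (Literature.NumberTheory.EllipticCurves.ratPlusSymbol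 f (((((Literature.NumberTheory.EllipticCurves.cyclotomicGenerator 2 : ZMod (2 ^ (n₁ + 2))) ^ s.val).val : ℚ) / (2 : ℚ) ^ (n₁ + 2))))‖

/-- (G′) — LEVEL-ONLY research text: rtt-p4 g5's curve-free spanning predicate at EVERY odd level («the closed loops `{0 → b/4^k}`,
`k ≥ 1`, span the kernel of the Shimura-quotient map on `H₁(X₀(N); 𝔽₂)`», dual form `SignedMuAtTwo.CuspSpanEvenAtTwo`). CONJECTURE-GRADE;
kit-verified for every odd `N ≤ 2999` and all 147 habitat⁺ conductors `< 10⁴`. Nothing asserted. -/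
def CuspSpanEvenAtTwoOdd : Prop :=
  ∀ (N : ℕ) [NeZero N], ¬ 2 ∣ N → SignedMuAtTwo.CuspSpanEvenAtTwo N

/-- The PUB text is the registered stub text (definitional). -/
theorem pubFactsKanPlus_iff : PubFactsKanPlus ↔
    (Literature.NumberTheory.EllipticCurves.ModularForms.eichlerShimura_depletedOptimalQuotient_periodLattice_of_dvd ∧
    WeierstrassCurve.isIsogenous_iff_frobeniusTrace_eq ∧
    Literature.NumberTheory.EllipticCurves.mazurKenku_exists_cyclic_isogeny ∧
    Literature.NumberTheory.EllipticCurves.ModularForms.heckeSelfDual_torsionBy_J0 ∧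
    Literature.NumberTheory.EllipticCurves.ModularForms.buzzard2000_multiplicityOne_gamma0 ∧
    Literature.NumberTheory.EllipticCurves.serre1972_supersingular_decompositionSubgroup_image ∧
    Literature.NumberTheory.EllipticCurves.ModularForms.Deligne1974_heckeT_eigenvalue_norm_le) :=
  Iff.rfl

/-- **Twin closer KanP**: PUB ∧ (μ-W₀) ⟹ the crux `ThetaLayerLambdaCongruenceAtTwo` BY NAME — one `exact` over the landed
`thetaLayerLambdaCongruenceAtTwo_of_facts_plusSymbolMax` (p609241). -/
theorem kanP_closes (hP : PubFactsKanPlus) (hμ : PlusSymbolMaxAtTwoPowerCusp) :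
    Summit.BirchSwinnertonDyer.BirchSwinnertonDyer.Theses.ResidualThetaTransportAtTwo.ThetaLayerLambdaCongruenceAtTwo :=
  ThetaLayerLambdaCongruenceAtTwo.thetaLayerLambdaCongruenceAtTwo_of_facts_plusSymbolMax
    hP.1 hP.2.1 hP.2.2.1 hP.2.2.2.1 hP.2.2.2.2.1 hP.2.2.2.2.2.1 hμ hP.2.2.2.2.2.2

/-- FLAT — CURVE-LEVEL research text of the sibling crux Kμ⁺: VERBATIM the registered stub `stub_flatMuZeroAtTwo : FlatMuZeroAtTwo`
of `Cruxes/SignedMuVanishingAtTwoPlus/Lines/birth.lean` («on the habitat⁺, `2 ∤ L⁻` for every Pollack pair of the newform at `2`»,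
μ(L♭_f) = 0, Pollack 2003 Conj. 6.3-shape at `p = 2`). CONJECTURE-GRADE. Nothing asserted. -/
def FlatMuZeroAtTwoText : Prop :=
  ∀ (W : WeierstrassCurve ℚ) [W.IsElliptic] [W.IsGloballyMinimal], ¬ W.HasCM → W.analyticRank = 0 → Literature.NumberTheory.EllipticCurves.Rank1Residual.GoodSS W 2 → W.frobeniusTrace 2 = 0 → W.Δ < 0 → ∀ [NeZero (W.conductorNorm ℤ)] (f : CuspForm (CongruenceSubgroup.Gamma0 (W.conductorNorm ℤ)) 2), Literature.NumberTheory.EllipticCurves.ModularForms.IsNewformOf W f → ∀ (Lplus Lminus : Literature.NumberTheory.EllipticCurves.IwasawaAlgebra 2), Summit.BirchSwinnertonDyer.Rank1Residual.Supersingular.IsPollackPair f 2 Lplus Lminus → ¬ PowerSeries.C (2 : ℤ_[2]) ∣ Lminus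

/-- **(μ-W₀) ⟺ FLAT in the kernel**: the research stub of Kan⁺ (v11) and the research stub of Kμ⁺ are ONE statement
(w2 g2's `curvePlusSymbolMax_iff_flatMuZeroAtTwo`, p611018). -/
theorem plusSymbolMax_iff_flat : PlusSymbolMaxAtTwoPowerCusp ↔ FlatMuZeroAtTwoText :=
  ThetaLayerLambdaCongruenceAtTwo.curvePlusSymbolMax_iff_flatMuZeroAtTwo

/-- **Twin closer over FLAT**: PUB ∧ FLAT ⟹ the crux BY NAME (p611018's
`thetaLayerLambdaCongruenceAtTwo_of_facts_flatMuZeroAtTwo_deligne`, equivalently `kanP_closes ∘ plusSymbolMax_iff_flat.mpr`). -/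
theorem kanP_closes_of_flat (hP : PubFactsKanPlus) (hF : FlatMuZeroAtTwoText) :
    Summit.BirchSwinnertonDyer.BirchSwinnertonDyer.Theses.ResidualThetaTransportAtTwo.ThetaLayerLambdaCongruenceAtTwo :=
  kanP_closes hP (plusSymbolMax_iff_flat.mpr hF)

/-- **Twin closer over the EXISTING item 21437**: PUB ∧ Abbes–Ullmo ∧ `SignedMuAnalyticAtTwoPlus` ⟹ the crux BY NAME
(21437 ⟹ FLAT granted Abbes–Ullmo: rtt-p4's `signedMuAnalyticAtTwoPlus_iff_flatMuZero_of_abbesUllmo`; then `kanP_closes_of_flat`). -/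
theorem kanP_closes_of_item21437 (hP : PubFactsKanPlus) (hAU : abbesUllmo_not_dvd_maninConstant_of_not_dvd_level)
    (hμ : Summit.BirchSwinnertonDyer.BirchSwinnertonDyer.Theses.ResidualThetaTransportAtTwo.SignedMuAnalyticAtTwoPlus) :
    Summit.BirchSwinnertonDyer.BirchSwinnertonDyer.Theses.ResidualThetaTransportAtTwo.ThetaLayerLambdaCongruenceAtTwo :=
  kanP_closes_of_flat hP
    ((Summit.BirchSwinnertonDyer.BirchSwinnertonDyer.Theorems.signedMuAnalyticAtTwoPlus_iff_flatMuZero_of_abbesUllmo hAU).mp hμ)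

/-- **FLAT ∧ Abbes–Ullmo ⟹ item 21437** (rtt-p4's `signedMuAnalyticAtTwoPlus_of_abbesUllmo_of_flatMuZero`): so modulo print the two
texts FLAT / (μ-W₀) and the EXISTING item 21437 are interchangeable as the research node. -/
theorem item21437_of_flat (hAU : abbesUllmo_not_dvd_maninConstant_of_not_dvd_level) (hF : FlatMuZeroAtTwoText) :
    Summit.BirchSwinnertonDyer.BirchSwinnertonDyer.Theses.ResidualThetaTransportAtTwo.SignedMuAnalyticAtTwoPlus :=
  Summit.BirchSwinnertonDyer.BirchSwinnertonDyer.Theorems.signedMuAnalyticAtTwoPlus_of_abbesUllmo_of_flatMuZero hAU hF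

/-- **Level node ⟹ FLAT** (all odd levels): (G′) ⟹ FLAT. -/
theorem flat_of_cuspSpanOdd (hG : CuspSpanEvenAtTwoOdd) : FlatMuZeroAtTwoText :=
  SignedMuAtTwo.flatMuZeroAtTwo_of_forall_cuspSpanEvenAtTwo (fun N _ hN ↦ hG N hN)

/-- **Level node ⟹ curve node** (all odd levels): (G′) ⟹ (μ-W₀) — w3 g4's `undepletedMax_of_forall_cuspSpanEvenAtTwo` (p609376). -/
theorem plusSymbolMax_of_cuspSpanOdd (hG : CuspSpanEvenAtTwoOdd) : PlusSymbolMaxAtTwoPowerCusp :=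
  ThetaLayerLambdaCongruenceAtTwo.undepletedMax_of_forall_cuspSpanEvenAtTwo (fun N _ hN ↦ hG N hN)

/-- **Level node at the habitat conductors only ⟹ curve node**: it suffices to have `CuspSpanEvenAtTwo N_W` for the conductors of
habitat⁺ curves (`undepletedMax_of_cuspSpanEvenAtTwo`, p609376). -/
theorem plusSymbolMax_of_cuspSpan_habitat
    (hG : ∀ (W : WeierstrassCurve ℚ) [W.IsElliptic] [W.IsGloballyMinimal], ¬ W.HasCM → W.analyticRank = 0 →
      Literature.NumberTheory.EllipticCurves.Rank1Residual.GoodSS W 2 → W.frobeniusTrace 2 = 0 → W.Δ < 0 →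
      ∀ [NeZero (W.conductorNorm ℤ)], SignedMuAtTwo.CuspSpanEvenAtTwo (W.conductorNorm ℤ)) :
    PlusSymbolMaxAtTwoPowerCusp := by
  intro W _ _ hCM hr hss ha hΔ _ f hf
  exact ThetaLayerLambdaCongruenceAtTwo.undepletedMax_of_cuspSpanEvenAtTwo hf hss ha (hG W hCM hr hss ha hΔ)

/-- **Twin closer over the level node**: PUB ∧ (G′) ⟹ the crux BY NAME. -/
theorem kanP_closes_of_cuspSpanOdd (hP : PubFactsKanPlus) (hG : CuspSpanEvenAtTwoOdd) :
    Summit.BirchSwinnertonDyer.BirchSwinnertonDyer.Theses.ResidualThetaTransportAtTwo.ThetaLayerLambdaCongruenceAtTwo :=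
  kanP_closes hP (plusSymbolMax_of_cuspSpanOdd hG)

/-- **The same level node serves Kμ⁺'s analytic child 21437** (rtt-p4 g5's
`signedMuAnalyticAtTwoPlus_of_abbesUllmo_of_forall_cuspSpanEvenAtTwo`, restated with the named text; Abbes–Ullmo Thm A by name). -/
theorem signedMuAnalytic_of_cuspSpanOdd
    (hAU : abbesUllmo_not_dvd_maninConstant_of_not_dvd_level) (hG : CuspSpanEvenAtTwoOdd) :
    Summit.BirchSwinnertonDyer.BirchSwinnertonDyer.Theses.ResidualThetaTransportAtTwo.SignedMuAnalyticAtTwoPlus :=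
  SignedMuAtTwo.signedMuAnalyticAtTwoPlus_of_abbesUllmo_of_forall_cuspSpanEvenAtTwo hAU (fun N _ hN ↦ hG N hN)

end Summit.BirchSwinnertonDyer.BirchSwinnertonDyer.Cruxes.ThetaLayerLambdaCongruenceAtTwo.KanPItemCert

end
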